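import Summits.AtomisticToContinuum.Crystallization.Theses.GappedShellCensus

/-!
# Crux `GappedShellCensus.TornFree` (stmt-AtomisticToContinuum-18069), line `Sketch` —
# stub `stub_tfRescale` (rescaling transfer)

The unit-scale statement "no bond `(0, v)` of a finite ALLGAP configuration `Y ∋ 0` of `ℝ³`
(every pair of distinct points at distance `≥ 0.98` and either `≤ 1.02` or `≥ 1.26`, at most
twelve bonded neighbours everywhere, exactly twelve within `3` of `0`) has `≤ 3` common
neighbours" gives the same statement at any scale `a > 0` about any base point `y ∈ Y`.

## Proof

Pure bookkeeping.  Put `f w = a⁻¹ • (w - y)`.  Then `f y = 0` and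
`dist (f p) (f q) = a⁻¹ * dist p q`; consequently `f` is injective and `‖f w‖ = a⁻¹ * dist y w`.
So `f '' Y` is finite, contains `0`, and each defining predicate of the unit-scale statement on
`f '' Y` corresponds under `f` to the scale-`a` predicate on `Y`
(`a⁻¹ * r ≤ c ↔ r ≤ a * c` and `c ≤ a⁻¹ * r ↔ a * c ≤ r` for `a > 0`).  The three `Set.ncard`
conditions transfer because the `P'`-part of `f '' Y` is the image of the `P`-part of `Y`
whenever `P' (f w) ↔ P w` (`tfRescale_ncard_sep`), and `Set.ncard` is invariant under injective
images.  The transfer for an abstract map `f` with the two displayed properties is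
`tfRescale_transfer`; the stub instantiates it with `f w = a⁻¹ • (w - y)`.
-/

noncomputable section

namespace Summit.AtomisticToContinuum.Crystallization.Theorems

open scoped RealInnerProductSpace

/-! ### Helpers -/

/-- `ncard` transfer along an injective map: if `P' (f w) ↔ P w` for `w ∈ S`, then the
`P'`-part of `f '' S` is the image of the `P`-part of `S`, hence has the same `ncard`. -/
private theorem tfRescale_ncard_sep {α β : Type*} {f : α → β} (hf : Function.Injective f)
    (S : Set α) {P : α → Prop} {P' : β → Prop} (h : ∀ w ∈ S, (P' (f w) ↔ P w)) :
    {w' ∈ f '' S | P' w'}.ncard = {w ∈ S | P w}.ncard := by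
  have himg : {w' ∈ f '' S | P' w'} = f '' {w ∈ S | P w} := by
    ext w'
    constructor
    · rintro ⟨⟨w, hw, rfl⟩, hP⟩
      exact ⟨w, ⟨hw, (h w hw).mp hP⟩, rfl⟩
    · rintro ⟨w, ⟨hw, hP⟩, rfl⟩
      exact ⟨⟨w, hw, rfl⟩, (h w hw).mpr hP⟩
  rw [himg, Set.ncard_image_of_injective _ hf]

/-- **Transfer along an abstract similarity.** If `f : ℝ³ → ℝ³` sends the base point `y` to `0`
and divides all distances by `a > 0`, then the unit-scale statement about `f '' Y` and the bond
`(0, f v)` yields the scale-`a` statement about `Y` and the bond `(y, v)`. -/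
private theorem tfRescale_transfer
    (hU : ∀ (Y : Set (EuclideanSpace ℝ (Fin 3))), Y.Finite → (0 : EuclideanSpace ℝ (Fin 3)) ∈ Y →
      (∀ p ∈ Y, ∀ q ∈ Y, p ≠ q → 1 - 1 / 50 ≤ dist p q ∧
        (dist p q ≤ 1 + 1 / 50 ∨ 63 / 50 ≤ dist p q)) →
      (∀ z ∈ Y, {w ∈ Y | w ≠ z ∧ dist z w ≤ 1 + 1 / 50}.ncard ≤ 12) →
      (∀ z ∈ Y, ‖z‖ ≤ 3 → {w ∈ Y | w ≠ z ∧ dist z w ≤ 1 + 1 / 50}.ncard = 12) →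
      ∀ v ∈ Y, v ≠ 0 → ‖v‖ ≤ 1 + 1 / 50 →
        {w ∈ Y | w ≠ 0 ∧ w ≠ v ∧ ‖w‖ ≤ 1 + 1 / 50 ∧ dist v w ≤ 1 + 1 / 50}.ncard ≤ 3 →
        False)
    {Y : Set (EuclideanSpace ℝ (Fin 3))} {a : ℝ} (ha : 0 < a) (hfin : Y.Finite)
    (hgap : ∀ p ∈ Y, ∀ q ∈ Y, p ≠ q → a * (1 - 1 / 50) ≤ dist p q ∧
        (dist p q ≤ a * (1 + 1 / 50) ∨ a * (63 / 50) ≤ dist p q))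
    (hle : ∀ z ∈ Y, {w ∈ Y | w ≠ z ∧ dist z w ≤ a * (1 + 1 / 50)}.ncard ≤ 12)
    {y : EuclideanSpace ℝ (Fin 3)} (hy : y ∈ Y)
    (htw : ∀ z ∈ Y, dist y z ≤ a * 3 →
        {w ∈ Y | w ≠ z ∧ dist z w ≤ a * (1 + 1 / 50)}.ncard = 12)
    {v : EuclideanSpace ℝ (Fin 3)} (hv : v ∈ Y) (hvy : v ≠ y) (hdv : dist y v ≤ a * (1 + 1 / 50))
    (h3 : {w ∈ Y | w ≠ y ∧ w ≠ v ∧ dist y w ≤ a * (1 + 1 / 50) ∧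
              dist v w ≤ a * (1 + 1 / 50)}.ncard ≤ 3)
    (f : EuclideanSpace ℝ (Fin 3) → EuclideanSpace ℝ (Fin 3)) (hfy : f y = 0)
    (hd : ∀ p q, dist (f p) (f q) = a⁻¹ * dist p q) : False := by
  -- `f` is injective, and `‖f w‖` is the rescaled distance to the base point
  have hf : Function.Injective f := fun p q h => by
    have h0 := hd p q
    rw [h, dist_self] at h0
    exact dist_eq_zero.mp ((mul_eq_zero.mp h0.symm).resolve_left (inv_ne_zero ha.ne'))
  have hn : ∀ w, ‖f w‖ = a⁻¹ * dist y w := fun w => by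
    rw [← dist_zero_right, ← hfy, hd, dist_comm]
  -- bonded-neighbour sets correspond
  have hnb : ∀ z, {w' ∈ f '' Y | w' ≠ f z ∧ dist (f z) w' ≤ 1 + 1 / 50}.ncard =
      {w ∈ Y | w ≠ z ∧ dist z w ≤ a * (1 + 1 / 50)}.ncard := fun z =>
    tfRescale_ncard_sep hf Y fun w _ => by rw [hf.ne_iff, hd, inv_mul_le_iff₀ ha]
  refine hU (f '' Y) (hfin.image f) ⟨y, hy, hfy⟩ ?_ ?_ ?_ (f v) ⟨v, hv, rfl⟩ ?_ ?_ ?_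
  · -- ALLGAP
    rintro _ ⟨p, hp, rfl⟩ _ ⟨q, hq, rfl⟩ hpq
    rw [hd, le_inv_mul_iff₀ ha, inv_mul_le_iff₀ ha, le_inv_mul_iff₀ ha]
    exact hgap p hp q hq (hf.ne_iff.mp hpq)
  · -- at most twelve bonded neighbours everywhere
    rintro _ ⟨z, hz, rfl⟩
    rw [hnb z]
    exact hle z hz
  · -- exactly twelve within `3` of the origin
    rintro _ ⟨z, hz, rfl⟩ hz3
    rw [hn, inv_mul_le_iff₀ ha] at hz3
    rw [hnb z]
    exact htw z hz hz3
  · -- the bond is a genuine bond: `f v ≠ 0 = f y`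
    exact (hf.ne_iff' hfy).mpr hvy
  · -- its length is `≤ 1.02`
    rw [hn, inv_mul_le_iff₀ ha]
    exact hdv
  · -- the common neighbours correspond
    have hc : {w' ∈ f '' Y | w' ≠ 0 ∧ w' ≠ f v ∧ ‖w'‖ ≤ 1 + 1 / 50 ∧
        dist (f v) w' ≤ 1 + 1 / 50}.ncard = {w ∈ Y | w ≠ y ∧ w ≠ v ∧
        dist y w ≤ a * (1 + 1 / 50) ∧ dist v w ≤ a * (1 + 1 / 50)}.ncard :=
      tfRescale_ncard_sep hf Y fun w _ => by
        rw [hf.ne_iff' hfy, hf.ne_iff, hn, hd, inv_mul_le_iff₀ ha, inv_mul_le_iff₀ ha]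
    rw [hc]
    exact h3

/-! ### The stub -/

/-- **Stub (rescaling transfer).** The unit-scale statement "no bond `(0, v)` of a finite ALLGAP
configuration `Y ∋ 0` (at most twelve everywhere, exactly twelve within `3` of `0`) has `≤ 3`
common neighbours" gives the same statement at any scale `a > 0` about any base point `y ∈ Y`:
apply it to `Y' = (fun w ↦ a⁻¹ • (w − y)) '' Y`, which is finite, contains `0`, has all distances
divided by `a` (`dist (a⁻¹ • (p − y)) (a⁻¹ • (q − y)) = a⁻¹ * dist p q`) and the same bond
combinatorics (`Set.ncard` is preserved under this injective map, and the defining predicates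
correspond). [folklore] -/
theorem stub_tfRescale :
    (∀ (Y : Set (EuclideanSpace ℝ (Fin 3))), Y.Finite → (0 : EuclideanSpace ℝ (Fin 3)) ∈ Y →
      (∀ p ∈ Y, ∀ q ∈ Y, p ≠ q → 1 - 1 / 50 ≤ dist p q ∧
        (dist p q ≤ 1 + 1 / 50 ∨ 63 / 50 ≤ dist p q)) →
      (∀ z ∈ Y, {w ∈ Y | w ≠ z ∧ dist z w ≤ 1 + 1 / 50}.ncard ≤ 12) →
      (∀ z ∈ Y, ‖z‖ ≤ 3 → {w ∈ Y | w ≠ z ∧ dist z w ≤ 1 + 1 / 50}.ncard = 12) →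
      ∀ v ∈ Y, v ≠ 0 → ‖v‖ ≤ 1 + 1 / 50 →
        {w ∈ Y | w ≠ 0 ∧ w ≠ v ∧ ‖w‖ ≤ 1 + 1 / 50 ∧ dist v w ≤ 1 + 1 / 50}.ncard ≤ 3 →
        False) →
    ∀ (Y : Set (EuclideanSpace ℝ (Fin 3))) (a : ℝ), 0 < a → Y.Finite →
      (∀ p ∈ Y, ∀ q ∈ Y, p ≠ q → a * (1 - 1 / 50) ≤ dist p q ∧
        (dist p q ≤ a * (1 + 1 / 50) ∨ a * (63 / 50) ≤ dist p q)) →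
      (∀ z ∈ Y, {w ∈ Y | w ≠ z ∧ dist z w ≤ a * (1 + 1 / 50)}.ncard ≤ 12) →
      ∀ y ∈ Y,
        (∀ z ∈ Y, dist y z ≤ a * 3 → {w ∈ Y | w ≠ z ∧ dist z w ≤ a * (1 + 1 / 50)}.ncard = 12) →
        ∀ v ∈ Y, v ≠ y → dist y v ≤ a * (1 + 1 / 50) →
          {w ∈ Y | w ≠ y ∧ w ≠ v ∧ dist y w ≤ a * (1 + 1 / 50) ∧
              dist v w ≤ a * (1 + 1 / 50)}.ncard ≤ 3 →
          False := by
  intro hU Y a ha hfin hgap hle y hy htw v hv hvy hdv h3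
  refine tfRescale_transfer hU ha hfin hgap hle hy htw hv hvy hdv h3 (fun w => a⁻¹ • (w - y))
    ?_ ?_
  · -- the base point goes to the origin
    show a⁻¹ • (y - y) = (0 : EuclideanSpace ℝ (Fin 3))
    rw [sub_self, smul_zero]
  · -- all distances are divided by `a`
    intro p q
    show dist (a⁻¹ • (p - y)) (a⁻¹ • (q - y)) = a⁻¹ * dist p q
    rw [dist_smul₀, dist_sub_right, Real.norm_eq_abs, abs_of_pos (inv_pos.2 ha)]

end Summit.AtomisticToContinuum.Crystallization.Theorems

end
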